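import Literature.NumberTheory.EllipticCurves.ZpExtensionEisensteinTwistCores
import Literature.NumberTheory.EllipticCurves.ZpExtensionEisensteinH1Limit
import HarnessLib

/-!
# The coefficient action of `A_{m,k} = Λ/(T^m + p, p^k)` on `H¹(K, M ⊗ A_{m,k}(ψ))` through the tree's
# scalar-action layer: `H¹(c •)` is `scalarMapH1`; the generators `[T] ↦ (1+T)• − id`, `[C c] ↦ (c mod p^k)•`,
# `X^{mk}`-divisible series `↦ 0`; and `κ̄⁻_J(γ) = −1` for the inverse extension (proofs file: theorems only)

Topic `NumberTheory/EllipticCurves` (sequel of `ZpExtensionScalarTwistMaps` / `ZpExtensionEisensteinTwistCores`,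
consumer of `GaloisRepresentations/GaloisCohomologyScalarAction`). The `A_{m,k}`-module structure of Howard's
`H¹(K, T_𝔮/p^k T_𝔮)` [Howard 2004, §2.2, Def. 2.2.3: "`H¹(K, T_𝔮)` is an `S_𝔮`-module"] is carried in the tree by the
Galois endomorphisms `κ.eisensteinTwistSMulHom ρ hm k c` (`x ↦ c • x`) under `galoisCohomology.map`
(`ZpExtension.EisensteinH1Data.proj_smul`). This file identifies that action with the generic scalar action
`galoisCohomology.scalarMapH1` of `GaloisCohomologyScalarAction` (the tree's `isScalarLinear_eisensteinTwist` /
`scalarMapH1_eisensteinTwist_eq` of `ZpExtensionEisensteinH1Limit`, element form here),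
so that additivity/multiplicativity/unit/integers come from that file, and computes the action of the generators of
`A_{m,k}`: `[T] = (1+T) − 1 ↦ H¹((1+T)•) − id` (the coefficient side of `T ↦ conj_γ − 1` on `𝔖`,
`LambdaAdicSelmerData.proj_X`, matched by `coresEisenstein_conjMap_of_layerIndex_eq_neg_one` at the inverse extension
`κ⁻ = κ.unitTwist (-1)`, whose index at a topological generator is `−1`, §1), `[C c] ↦ ((c mod p^k) : ℤ)•`
(`proj_C`), and power series without terms of degree `< mk ↦ 0` (`proj_cont`). THEOREMS ONLY; no definition, no
named fact, no instance, no `sorry`. Cell `pub/bsd-print-x9`, D1 road of the shared μ-residual of rows 9/10 (the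
`Λ`-linearity bookkeeping of the compact control map `𝔖_p(K_∞) → H¹(K, T_𝔮)`). BSD is not proved here.

References: [Howard2004HeegnerKolyvagin] B. Howard, Compositio Math. 140 (2004), §2.2, Def. 2.2.3, proof of Thm. 2.2.10
(`𝔮 = T^m + p`); [SerreGaloisCohomology1997] I §2.2; [Washington1997] §7.1, §13.1–§13.2; [PerrinRiou1987BSMF] §0 p. 401.
-/

noncomputable section

open scoped TensorProduct Topology ContRepresentation
open Field CategoryTheory

universe u

namespace Literature.NumberTheory.EllipticCurves

open Literature.NumberTheory.GaloisRepresentations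

namespace ZpExtension

variable {K : Type u} [Field K] {p : ℕ} [hp : Fact p.Prime] (κ : ZpExtension K p)

/-! ## §1 The inverse extension `κ⁻ = κ.unitTwist (-1)`: `κ̄⁻_J(γ) = −1` -/

/-- For a topological generator `γ` of `κ` (`κ γ = 1`) the inverse extension `κ⁻ = κ.unitTwist (-1)` has
`κ̄⁻_J(γ) = −1` at every level `J` (so `coresEisenstein_conjMap_of_layerIndex_eq_neg_one` applies to `γ` itself: the
control map built on `κ⁻` is `Λ`-linear for `T ↦ conj_γ − 1`). [cite: Washington1997, §13.1–§13.2] -/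
theorem layerIndex_unitTwist_neg_one_of_isTopGenerator {γ : absoluteGaloisGroup K} (hγ : κ.IsTopGenerator γ)
    (J : ℕ) : (κ.unitTwist (-1)).layerIndex J γ = -1 := by
  have h1 : κ.layerIndex J γ = 1 := κ.layerIndex_eq_one_of_isTopGenerator J hγ
  unfold layerIndex at h1 ⊢
  rw [unitTwist_apply, toAdd_ofAdd, Units.val_neg, Units.val_one, neg_one_mul, map_neg, h1]

/-! ## §2 `H¹(c •)` is the scalar action `scalarMapH1` of `GaloisCohomologyScalarAction` -/

section CoeffAction

variable {M : Type u} [AddCommGroup M] [TopologicalSpace M] [DiscreteTopology M]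
  (ρ : DiscreteGaloisModule K M) {m : ℕ} (hm : 1 ≤ m) (k : ℕ)

/-- **`H¹(c •) x = scalarMapH1 c x`**: the action of `c ∈ A_{m,k}` on `H¹(K, M ⊗ A_{m,k}(ψ))` used by
`EisensteinH1Data.proj_smul` is the scalar action of `GaloisCohomologyScalarAction` (the tree's
`scalarMapH1_eisensteinTwist_eq`, `rfl`; element form), so that the latter's `scalarMapH1_add/_mul/_one/_zero/_intCast`
apply. [cite: Howard2004HeegnerKolyvagin, §2.2 and Def. 2.2.3 (H¹(K, T_𝔮) is an S_𝔮-module)] -/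
theorem map_eisensteinTwistSMulHom_eq_scalarMapH1 (c : IwasawaAlgebra.EisensteinCoeff p m k)
    (x : galoisCohomology (κ.eisensteinTwist ρ hm k) 1) :
    galoisCohomology.map (κ.eisensteinTwistSMulHom ρ hm k c) 1 x =
      galoisCohomology.scalarMapH1 (κ.eisensteinTwist ρ hm k) (κ.isScalarLinear_eisensteinTwist ρ hm k) c x :=
  rfl

/-- Additivity: `H¹((a + b) •) x = H¹(a •) x + H¹(b •) x`. [cite: Howard2004HeegnerKolyvagin, §2.2 and Def. 2.2.3] -/
theorem map_eisensteinTwistSMulHom_add (a b : IwasawaAlgebra.EisensteinCoeff p m k)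
    (x : galoisCohomology (κ.eisensteinTwist ρ hm k) 1) :
    galoisCohomology.map (κ.eisensteinTwistSMulHom ρ hm k (a + b)) 1 x =
      galoisCohomology.map (κ.eisensteinTwistSMulHom ρ hm k a) 1 x +
        galoisCohomology.map (κ.eisensteinTwistSMulHom ρ hm k b) 1 x := by
  rw [map_eisensteinTwistSMulHom_eq_scalarMapH1, map_eisensteinTwistSMulHom_eq_scalarMapH1,
    map_eisensteinTwistSMulHom_eq_scalarMapH1, galoisCohomology.scalarMapH1_add, AddMonoidHom.add_apply]

/-- Multiplicativity: `H¹((a b) •) x = H¹(a •) (H¹(b •) x)`. [cite: Howard2004HeegnerKolyvagin, §2.2 and Def. 2.2.3] -/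
theorem map_eisensteinTwistSMulHom_mul (a b : IwasawaAlgebra.EisensteinCoeff p m k)
    (x : galoisCohomology (κ.eisensteinTwist ρ hm k) 1) :
    galoisCohomology.map (κ.eisensteinTwistSMulHom ρ hm k (a * b)) 1 x =
      galoisCohomology.map (κ.eisensteinTwistSMulHom ρ hm k a) 1
        (galoisCohomology.map (κ.eisensteinTwistSMulHom ρ hm k b) 1 x) := by
  rw [map_eisensteinTwistSMulHom_eq_scalarMapH1, map_eisensteinTwistSMulHom_eq_scalarMapH1,
    map_eisensteinTwistSMulHom_eq_scalarMapH1, galoisCohomology.scalarMapH1_mul, AddMonoidHom.comp_apply]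

/-- Unit: `H¹(1 •) x = x`. [cite: Howard2004HeegnerKolyvagin, §2.2 and Def. 2.2.3] -/
theorem map_eisensteinTwistSMulHom_one (x : galoisCohomology (κ.eisensteinTwist ρ hm k) 1) :
    galoisCohomology.map (κ.eisensteinTwistSMulHom ρ hm k 1) 1 x = x := by
  rw [map_eisensteinTwistSMulHom_eq_scalarMapH1, galoisCohomology.scalarMapH1_one, AddMonoidHom.id_apply]

/-- Zero: `H¹(0 •) x = 0`. [cite: Howard2004HeegnerKolyvagin, §2.2 and Def. 2.2.3] -/
theorem map_eisensteinTwistSMulHom_zero (x : galoisCohomology (κ.eisensteinTwist ρ hm k) 1) :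
    galoisCohomology.map (κ.eisensteinTwistSMulHom ρ hm k 0) 1 x = 0 := by
  rw [map_eisensteinTwistSMulHom_eq_scalarMapH1, galoisCohomology.scalarMapH1_zero, AddMonoidHom.zero_apply]

/-- Integers act as integers: `H¹((z : A_{m,k}) •) x = z • x`. [cite: Howard2004HeegnerKolyvagin, §2.2 and Def. 2.2.3] -/
theorem map_eisensteinTwistSMulHom_intCast (z : ℤ) (x : galoisCohomology (κ.eisensteinTwist ρ hm k) 1) :
    galoisCohomology.map (κ.eisensteinTwistSMulHom ρ hm k (z : IwasawaAlgebra.EisensteinCoeff p m k)) 1 x = z • x := by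
  rw [map_eisensteinTwistSMulHom_eq_scalarMapH1, galoisCohomology.scalarMapH1_intCast]

/-- Equal coefficients give equal maps (for rewriting under `galoisCohomology.map`). [cite: Howard2004HeegnerKolyvagin, §2.2] -/
theorem map_eisensteinTwistSMulHom_congr {a b : IwasawaAlgebra.EisensteinCoeff p m k} (h : a = b)
    (x : galoisCohomology (κ.eisensteinTwist ρ hm k) 1) :
    galoisCohomology.map (κ.eisensteinTwistSMulHom ρ hm k a) 1 x =
      galoisCohomology.map (κ.eisensteinTwistSMulHom ρ hm k b) 1 x := by
  rw [h]

/-! ## §3 The generators: `[T] ↦ (1+T)• − id`, `[C c] ↦ (c mod p^k)•`, `X^{mk}`-divisible series `↦ 0` -/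

/-- `[1 + T] = 1 + [T]` in `A_{m,k}`, i.e. `onePlusT = 1 + [T]`. [cite: Howard2004HeegnerKolyvagin, §2.2] -/
theorem onePlusT_eq_one_add_mk_X :
    IwasawaAlgebra.EisensteinCoeff.onePlusT p m k =
      1 + (Ideal.Quotient.mk _ PowerSeries.X : IwasawaAlgebra.EisensteinCoeff p m k) := by
  rw [IwasawaAlgebra.EisensteinCoeff.onePlusT_def, map_add, map_one]

/-- **`[T]` acts as `(1+T)• − id`**: `H¹([T] •) x = H¹((1+T) •) x − x` — the coefficient side of `T ↦ conj_γ − 1`.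
[cite: Howard2004HeegnerKolyvagin, §2.2 (Γ_K acts on Λ through γ ↦ 1 + T)] [cite: Washington1997, §13.1–§13.2] -/
theorem map_eisensteinTwistSMulHom_mk_X (x : galoisCohomology (κ.eisensteinTwist ρ hm k) 1) :
    galoisCohomology.map (κ.eisensteinTwistSMulHom ρ hm k
        (Ideal.Quotient.mk _ PowerSeries.X : IwasawaAlgebra.EisensteinCoeff p m k)) 1 x =
      galoisCohomology.map (κ.eisensteinTwistSMulHom ρ hm k (IwasawaAlgebra.EisensteinCoeff.onePlusT p m k)) 1 x - x := by
  rw [eq_sub_iff_add_eq, κ.map_eisensteinTwistSMulHom_congr ρ hm k (onePlusT_eq_one_add_mk_X (p := p) (m := m) k) x,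
    map_eisensteinTwistSMulHom_add, map_eisensteinTwistSMulHom_one]
  exact add_comm _ _

omit hp in
/-- **`[C c] = (c mod p^k)` in `A_{m,k}`**: the class of a constant `c ∈ ℤ_p` is the integer `appr c k`
(`PadicInt.appr_spec`: `c − appr c k ∈ p^k ℤ_p`). [cite: Washington1997, §7.1] [cite: Howard2004HeegnerKolyvagin, §2.2] -/
theorem mk_C_eq_natCast_appr [Fact p.Prime] (c : ℤ_[p]) :
    (Ideal.Quotient.mk _ (PowerSeries.C c) : IwasawaAlgebra.EisensteinCoeff p m k) = (c.appr k : ℕ) := by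
  rw [← map_natCast (Ideal.Quotient.mk _), Ideal.Quotient.eq]
  refine Ideal.mem_sup_right ?_
  have h := PadicInt.appr_spec k c
  rw [Ideal.mem_span_singleton] at h ⊢
  obtain ⟨d, hd⟩ := h
  exact ⟨PowerSeries.C d, by rw [← map_natCast (PowerSeries.C (R := ℤ_[p])), ← map_sub, hd, map_mul]⟩

omit hp in
/-- `(toZModPow k c).val = appr c k` (the canonical representative). [cite: Washington1997, §7.1] -/
theorem val_toZModPow_eq_appr [Fact p.Prime] (c : ℤ_[p]) : (PadicInt.toZModPow k c).val = c.appr k := by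
  change ((c.appr k : ℕ) : ZMod (p ^ k)).val = c.appr k
  rw [ZMod.val_natCast, Nat.mod_eq_of_lt (PadicInt.appr_lt c k)]

/-- **`[C c]` acts as the integer `c mod p^k`**: `H¹([C c] •) x = ((c mod p^k) : ℤ) • x` — the coefficient side of
`LambdaAdicSelmerData.proj_C` (constants act through `ℤ_p → ℤ/p^k` on `H¹(K_n, E[p^k])`, spelled with
`(PadicInt.toZModPow k c).val`). [cite: Howard2004HeegnerKolyvagin, §2.2 and Def. 2.2.3] [cite: PerrinRiou1987BSMF, §0 p. 401] -/
theorem map_eisensteinTwistSMulHom_mk_C (c : ℤ_[p]) (x : galoisCohomology (κ.eisensteinTwist ρ hm k) 1) :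
    galoisCohomology.map (κ.eisensteinTwistSMulHom ρ hm k
        (Ideal.Quotient.mk _ (PowerSeries.C c) : IwasawaAlgebra.EisensteinCoeff p m k)) 1 x =
      ((PadicInt.toZModPow k c).val : ℤ) • x := by
  rw [κ.map_eisensteinTwistSMulHom_congr ρ hm k (mk_C_eq_natCast_appr (p := p) (m := m) k c) x,
    val_toZModPow_eq_appr,
    κ.map_eisensteinTwistSMulHom_congr ρ hm k
      (show ((c.appr k : ℕ) : IwasawaAlgebra.EisensteinCoeff p m k) = ((c.appr k : ℤ) : _) by
        rw [Int.cast_natCast]) x,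
    map_eisensteinTwistSMulHom_intCast]

omit hp in
/-- **A power series with no terms of degree `< mk` is `0` in `A_{m,k}`** (`X^{mk} ∈ (q_m, p^k)`, tree
`X_pow_mul_mem_span_qm_sup_span_C_pow`; Mathlib `PowerSeries.X_pow_dvd_iff`) — the coefficient side of
`LambdaAdicSelmerData.proj_cont`. [cite: Howard2004HeegnerKolyvagin, §2.2] [cite: Washington1997, §7.1] -/
theorem mk_eq_zero_of_forall_coeff_eq_zero [Fact p.Prime] (g : IwasawaAlgebra p)
    (hg : ∀ i < m * k, PowerSeries.coeff i g = 0) :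
    (Ideal.Quotient.mk _ g : IwasawaAlgebra.EisensteinCoeff p m k) = 0 := by
  obtain ⟨q, hq⟩ := (PowerSeries.X_pow_dvd_iff (n := m * k) (φ := g)).2 hg
  rw [Ideal.Quotient.eq_zero_iff_mem, hq]
  exact Ideal.mul_mem_right _ _ (IwasawaAlgebra.X_pow_mul_mem_span_qm_sup_span_C_pow p m k)

/-- Hence such a power series acts by `0` on `H¹(K, M ⊗ A_{m,k}(ψ))`: `H¹([g] •) x = 0`.
[cite: Howard2004HeegnerKolyvagin, §2.2 and Def. 2.2.3] -/
theorem map_eisensteinTwistSMulHom_mk_eq_zero_of_forall_coeff_eq_zero (g : IwasawaAlgebra p)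
    (hg : ∀ i < m * k, PowerSeries.coeff i g = 0) (x : galoisCohomology (κ.eisensteinTwist ρ hm k) 1) :
    galoisCohomology.map (κ.eisensteinTwistSMulHom ρ hm k
        (Ideal.Quotient.mk _ g : IwasawaAlgebra.EisensteinCoeff p m k)) 1 x = 0 := by
  rw [κ.map_eisensteinTwistSMulHom_congr ρ hm k (mk_eq_zero_of_forall_coeff_eq_zero (p := p) (m := m) (k := k) g hg) x,
    map_eisensteinTwistSMulHom_zero]

end CoeffAction

end ZpExtension

end Literature.NumberTheory.EllipticCurves

end
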